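import Literature.NumberTheory.Sieve.Maynard2016Prop92LocalPairSum
import Literature.NumberTheory.Sieve.FGKMT2018LocalPairSumTotal
import Literature.NumberTheory.Sieve.FGKMT2018LocalClassCount
import HarnessLib

/-!
# Maynard 2016, Proposition 9.2 for `𝒜 = ℤ` — `∑_s T^{(m)}(r,s) = φ_ω(r)` (the count behind (9.15))

Sources: J. Maynard, *Dense clusters of primes in subsets*, Compositio Math. 152 (2016) 1517–1554 =
arXiv:1405.2593 [Maynard2016DenseClusters], proof of Proposition 9.2, p. 22 (displays (9.12)–(9.15));
proof of Proposition 9.1 pp. 19–20 (the model count «`ω(p) − 1` choices»).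

Step (T) of the exact-algebra leaf `Maynard2016Prop92Regroup` (M1): the `φ_L`-twisted twin of
`FGKMT2018LocalPairSumTotal`. For `r ∈ dkBoxP` (so `r_m = 1`, `(r_j, a_j b_m − a_m b_j) = 1`) with
`∏ rᵢ ≤ ⌊R⌋`, the vectors `s ∈ dkBoxP` with `∏ sᵢ = ∏ rᵢ` place each prime `p ∣ r_j` at an index
`j'` of the restricted admissible set
`admIdxM = {j' ∈ admIdx(p) : j' ≠ m, p ∤ a_{j'} b_m − a_m b_{j'}}`, whose size is `ω(p) − 1` if
`p ∤ a_m` (the index carrying the root of `L_m` is excluded) and `ω(p)` if `p ∣ a_m`; since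
`φ_L(p) = p − 1` resp. `p` in the two cases, `φ_L(p) − #admIdxM = p − ω(p)` always
(`totForm_sub_card_admIdxM`), and peeling with (9.12) gives

* `sum_localPairSumM_eq_phiOmega` — **`∑_{s ∈ dkBoxP} T^{(m)}(r,s) = ∏_{p ∣ r} (S_p^{(m)}(p ∣ (r,s)) + (#admIdxM − 1)·(−1)) = φ_ω(∏ rᵢ)`**,
  the exact identity which makes the diagonal of the regrouped form `∑_r (y^{(m)}_r)²/φ_ω(r)` (display (9.15)).

## References
* J. Maynard, *Dense clusters of primes in subsets*, Compositio Math. 152 (2016), proof of Prop. 9.2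
  p. 22, (9.12)–(9.15); proof of Prop. 9.1 pp. 19–20 [Maynard2016DenseClusters].
* K. Ford, B. Green, S. Konyagin, J. Maynard, T. Tao, *Long gaps between primes*, JAMS 31 (2018),
  Thm 6 (7.13) [FordGreenKonyaginMaynardTao2018].
-/

noncomputable section

open Finset
open scoped ArithmeticFunction.Moebius

namespace Literature.NumberTheory.Sieve.FGKMT2018

variable {k : ℕ}

/-! ### The restricted admissible indices -/

/-- The admissible indices at `p` for the restricted box `dkBoxP`: `j ∈ admIdx(p)` with `j ≠ m` and
`p ∤ |a_j b_m − a_m b_j|`. [cite: Maynard2016DenseClusters, proof of Prop. 9.2 p. 21 (𝒟'_k, d_m = 1) and p. 22 (count behind (9.15))] -/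
def admIdxM (L : Fin k → ℤ × ℤ) (m : Fin k) (p : ℕ) : Finset (Fin k) :=
  (admIdx L p).filter fun j => j ≠ m ∧ ¬ p ∣ (crossDet L m j).natAbs

/-- Membership in `admIdxM`. [cite: Maynard2016DenseClusters, proof of Prop. 9.2 pp. 21–22] -/
theorem mem_admIdxM {L : Fin k → ℤ × ℤ} {m : Fin k} {p : ℕ} {j : Fin k} :
    j ∈ admIdxM L m p ↔ j ∈ admIdx L p ∧ j ≠ m ∧ ¬ p ∣ (crossDet L m j).natAbs := by
  unfold admIdxM; rw [Finset.mem_filter]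

/-- Putting a prime `p ∤ ∏sᵢ`, `(p, WB) = 1`, at an index `j ∈ admIdxM` keeps `s ∈ dkBoxP`
(`s_j p ≤ ⌊R⌋`). [cite: Maynard2016DenseClusters, proof of Prop. 9.2 p. 22 («choices of s»)] -/
theorem update_mul_mem_dkBoxP {L : Fin k → ℤ × ℤ} {B : ℕ} {R : ℝ} {m : Fin k} {s : Fin k → ℕ}
    (hs : s ∈ dkBoxP L B R m) {p : ℕ} (hp : p.Prime) {j : Fin k} (hj : j ∈ admIdxM L m p)
    (hps : ¬ p ∣ ∏ i, s i) (hpW : p.Coprime (wCut k B * B)) (hb : s j * p ≤ ⌊R⌋₊) :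
    Function.update s j (s j * p) ∈ dkBoxP L B R m := by
  rw [mem_dkBoxP_iff] at hs ⊢
  obtain ⟨hsbox, hsm, hscop⟩ := hs
  obtain ⟨hjadm, hjm, hjΔ⟩ := mem_admIdxM.1 hj
  refine ⟨update_mul_mem_dkBox hsbox hp hjadm hps hpW hb, ?_, fun i hi => ?_⟩
  · rw [Function.update_of_ne (Ne.symm hjm)]; exact hsm
  · by_cases hij : i = j
    · subst hij
      rw [Function.update_self]
      exact Nat.Coprime.mul_left (hscop i hi) ((Nat.Prime.coprime_iff_not_dvd hp).2 hjΔ)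
    · rw [Function.update_of_ne hij]; exact hscop i hi

/-! ### `φ_L(p)` and `#admIdxM` -/

/-- `φ_L(p) = p` if `p ∣ a`, `φ_L(p) = p − 1` if `p ∤ a` (`p` prime). [cite: Maynard2016DenseClusters, §6 p. 11 (φ_L), proof of Prop. 9.2 p. 22 («p − 2»)] -/
theorem totForm_prime (l : ℤ × ℤ) (hl : l.1 ≠ 0) {p : ℕ} (hp : p.Prime) :
    totForm l p = if p ∣ l.1.natAbs then (p : ℝ) else (p : ℝ) - 1 := by
  unfold totForm
  have ha : l.1.natAbs ≠ 0 := Int.natAbs_ne_zero.2 hl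
  have hφ : (Nat.totient l.1.natAbs : ℝ) ≠ 0 := by
    exact_mod_cast (Nat.totient_pos.2 (Nat.pos_of_ne_zero ha)).ne'
  split_ifs with hpa
  · rw [mul_comm, Nat.totient_mul_of_prime_of_dvd hp hpa]
    push_cast
    field_simp
  · rw [Nat.totient_mul (Nat.coprime_comm.1 ((Nat.Prime.coprime_iff_not_dvd hp).2 hpa)),
      Nat.totient_prime hp]
    push_cast
    rw [Nat.cast_sub hp.one_le]
    push_cast
    field_simp

/-- For `j ∈ admIdx(p) \ admIdxM` with root `n`: `p ∣ L_m(n)`. [cite: Maynard2016DenseClusters, proof of Prop. 9.2 p. 22] -/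
private theorem dvd_formEval_m_of_not_mem {L : Fin k → ℤ × ℤ} (hadm : FormsAdmissible L)
    {m : Fin k} {p : ℕ} (hp : p.Prime) {j : Fin k} {n : ℤ} (hn : (p : ℤ) ∣ formEval (L j) n)
    (hK : ¬ (j ≠ m ∧ ¬ p ∣ (crossDet L m j).natAbs)) : (p : ℤ) ∣ formEval (L m) n := by
  by_cases hjm : j = m
  · subst hjm; exact hn
  · have hΔ : p ∣ (crossDet L m j).natAbs := by
      by_contra h; exact hK ⟨hjm, h⟩
    have hΔZ : (p : ℤ) ∣ crossDet L m j := Int.natCast_dvd.2 hΔ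
    have h1 : (p : ℤ) ∣ (L j).1 * formEval (L m) n := by
      have e : (L j).1 * formEval (L m) n = crossDet L m j + (L m).1 * formEval (L j) n := by
        rw [← fst_mul_formEval_sub L m j n]; ring
      rw [e]; exact dvd_add hΔZ (hn.mul_left _)
    rcases (Nat.prime_iff_prime_int.1 hp).dvd_or_dvd h1 with h | h
    · exact absurd h (not_intDvd_fst_of_dvd_formEval hadm j hp hn)
    · exact h

/-- **`#admIdxM = ω(p) − [p ∤ a_m]`**: of the `ω(p)` admissible indices exactly the one carrying the
root of `L_m (mod p)` is excluded when `p ∤ a_m`, none when `p ∣ a_m`.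
[cite: Maynard2016DenseClusters, proof of Prop. 9.2 p. 22 (the count giving (9.15)); §7 p. 13] -/
theorem card_admIdxM_add {L : Fin k → ℤ × ℤ} (hadm : FormsAdmissible L) (m : Fin k) {p : ℕ}
    (hp : p.Prime) :
    #(admIdxM L m p) + (if p ∣ (L m).1.natAbs then 0 else 1) = omegaL L p := by
  classical
  have hK : #((admIdx L p).filter (fun j => ¬ (j ≠ m ∧ ¬ p ∣ (crossDet L m j).natAbs))) =
      if p ∣ (L m).1.natAbs then 0 else 1 := by
    by_cases hpa : p ∣ (L m).1.natAbs
    · rw [if_pos hpa, Finset.card_eq_zero, Finset.filter_eq_empty_iff]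
      intro j hj hK
      obtain ⟨n, -, hn, -⟩ := mem_admIdx.1 hj
      exact not_intDvd_fst_of_dvd_formEval hadm m hp (dvd_formEval_m_of_not_mem hadm hp hn hK)
        (Int.natCast_dvd.2 hpa)
    · rw [if_neg hpa]
      have hpaZ : ¬ (p : ℤ) ∣ (L m).1 := fun h => hpa (Int.natCast_dvd.1 h)
      refine le_antisymm ?_ ?_
      · -- at most one element: two excluded indices share the root of `L_m`
        refine Finset.card_le_one.2 fun j₁ hj₁ j₂ hj₂ => ?_
        obtain ⟨hj₁a, hK₁⟩ := Finset.mem_filter.1 hj₁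
        obtain ⟨hj₂a, hK₂⟩ := Finset.mem_filter.1 hj₂
        obtain ⟨n₁, hn₁r, hn₁, hmin₁⟩ := mem_admIdx.1 hj₁a
        obtain ⟨n₂, hn₂r, hn₂, hmin₂⟩ := mem_admIdx.1 hj₂a
        have hm₁ := dvd_formEval_m_of_not_mem hadm hp hn₁ hK₁
        have hm₂ := dvd_formEval_m_of_not_mem hadm hp hn₂ hK₂
        have hsub := root_unique (L m) hp hpaZ hm₁ hm₂
        have hlt1 := Finset.mem_range.1 hn₁r
        have hlt2 := Finset.mem_range.1 hn₂r
        have h0 : ((n₁ : ℤ) - n₂) = 0 :=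
          Int.eq_zero_of_abs_lt_dvd hsub (abs_sub_lt_iff.2 ⟨by omega, by omega⟩)
        have heq : n₁ = n₂ := by omega
        subst heq
        rcases lt_trichotomy j₁ j₂ with h | h | h
        · exact absurd hn₁ (hmin₂ j₁ h)
        · exact h
        · exact absurd hn₂ (hmin₁ j₂ h)
      · -- at least one: the least index dividing at the root of `L_m`
        have hgcd : Int.gcd (L m).1 p = 1 := by
          rw [Int.gcd_eq_natAbs, Int.natAbs_natCast]
          exact Nat.coprime_comm.1 ((Nat.Prime.coprime_iff_not_dvd hp).2 hpa)
        have hroot := card_range_filter_dvd_formEval_eq_one (L m) hp.pos hgcd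
        obtain ⟨n, hn⟩ := Finset.card_pos.1 (by rw [hroot]; exact Nat.one_pos)
        obtain ⟨hnr, hnm⟩ := Finset.mem_filter.1 hn
        set J := (Finset.univ : Finset (Fin k)).filter fun j => (p : ℤ) ∣ formEval (L j) n with hJ
        have hJne : J.Nonempty := ⟨m, Finset.mem_filter.2 ⟨Finset.mem_univ m, hnm⟩⟩
        have hj₀ := Finset.min'_mem J hJne
        have hj₀dvd : (p : ℤ) ∣ formEval (L (J.min' hJne)) n := (Finset.mem_filter.1 hj₀).2
        rw [Nat.one_le_iff_ne_zero, Ne, Finset.card_eq_zero, ← Ne, ← Finset.nonempty_iff_ne_empty]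
        refine ⟨J.min' hJne, Finset.mem_filter.2 ⟨?_, ?_⟩⟩
        · refine mem_admIdx.2 ⟨n, hnr, hj₀dvd, fun j' hj' hdvd => ?_⟩
          have hle := Finset.min'_le J j' (Finset.mem_filter.2 ⟨Finset.mem_univ j', hdvd⟩)
          exact absurd hj' (not_lt.2 hle)
        · rintro ⟨hjm, hΔ⟩
          apply hΔ
          have hΔZ : (p : ℤ) ∣ crossDet L m (J.min' hJne) := by
            rw [← fst_mul_formEval_sub L m (J.min' hJne) n]
            exact dvd_sub (hnm.mul_left _) (hj₀dvd.mul_left _)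
          exact Int.natCast_dvd.1 hΔZ
  unfold admIdxM
  rw [← hK, Finset.card_filter_add_card_filter_not, card_admIdx hadm hp]

/-- **`φ_L(p) − #admIdxM = p − ω(p)`** for every prime `p` (admissible `𝓛`): the twist `φ_L` and the
restriction of the indices compensate exactly. [cite: Maynard2016DenseClusters, proof of Prop. 9.2 p. 22 («the presence of φ_L slightly changes the value of S_p», (9.15))] -/
theorem totForm_sub_card_admIdxM {L : Fin k → ℤ × ℤ} (hadm : FormsAdmissible L) (m : Fin k)
    {p : ℕ} (hp : p.Prime) :
    totForm (L m) p - #(admIdxM L m p) = (p : ℝ) - omegaL L p := by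
  have h := card_admIdxM_add hadm m hp
  rw [totForm_prime (L m) (hadm.1 m) hp]
  split_ifs at h ⊢ with hpa
  · rw [add_zero] at h; rw [h]
  · have h' : (#(admIdxM L m p) : ℝ) + 1 = omegaL L p := by exact_mod_cast h
    linarith

/-! ### `∑_s T^{(m)}(r,s) = φ_ω(r)` -/

/-- **`∑_{s ∈ dkBoxP, ∏s = N} T^{(m)}(r,s) = φ_ω(N)`** for `r ∈ dkBoxP` with `∏rᵢ = N ≤ ⌊R⌋`
(induction on `N`, peeling one prime with (9.12)). [cite: Maynard2016DenseClusters, proof of Prop. 9.2 p. 22 (from (9.12)–(9.13) to (9.15))] -/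
theorem sum_filter_localPairSumM_eq_phiOmega {L : Fin k → ℤ × ℤ} (hadm : FormsAdmissible L)
    (B : ℕ) (R : ℝ) (m : Fin k) :
    ∀ (N : ℕ) (r : Fin k → ℕ), r ∈ dkBoxP L B R m → (∏ i, r i) = N → N ≤ ⌊R⌋₊ →
      ∑ s ∈ (dkBoxP L B R m).filter (fun s => (∏ i, s i) = N), localPairSumM L B R m r s =
        phiOmega L N := by
  classical
  have hl : (L m).1 ≠ 0 := hadm.1 m
  intro N
  induction N using Nat.strong_induction_on with
  | _ N ih =>
    intro r hr hrN hNR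
    have hrbox := dkBoxP_subset L B R m hr
    by_cases hN1 : N = 1
    · subst hN1
      have hr1 : r = fun _ => 1 := funext fun i => Nat.dvd_one.1 (by
        rw [← hrN]; exact Finset.dvd_prod_of_mem r (Finset.mem_univ i))
      subst hr1
      have hset : (dkBoxP L B R m).filter (fun s => (∏ i, s i) = 1) = {fun _ => 1} := by
        ext s
        simp only [Finset.mem_filter, Finset.mem_singleton]
        constructor
        · rintro ⟨-, hs1⟩
          exact funext fun i => Nat.dvd_one.1 (by
            rw [← hs1]; exact Finset.dvd_prod_of_mem s (Finset.mem_univ i))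
        · rintro rfl; exact ⟨hr, by simp⟩
      rw [hset, Finset.sum_singleton, localPairSumM_one_one hl hr]
      unfold phiOmega
      rw [Nat.primeFactors_one, Finset.prod_empty]
    · -- inductive step: peel the least prime of `N`
      have hN0 : 0 < N := by
        rw [← hrN]; exact Finset.prod_pos fun i _ => one_le_of_mem_dkBox hrbox i
      have hp : N.minFac.Prime := Nat.minFac_prime hN1
      have hpN : N.minFac ∣ N := Nat.minFac_dvd N
      have hsqN : Squarefree N := by rw [← hrN]; exact squarefree_of_mem_dkBox hrbox
      have hcopN : N.Coprime (wCut k B * B) := by rw [← hrN]; exact (mem_dkBox_iff.1 hrbox).2.2.1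
      have hpW : N.minFac.Coprime (wCut k B * B) := Nat.Coprime.coprime_dvd_left hpN hcopN
      have hndiv : ¬ N.minFac ∣ N / N.minFac := by
        rw [Nat.dvd_div_iff_mul_dvd hpN]
        exact fun h => hp.not_isUnit (hsqN _ h)
      have hpr : N.minFac ∣ ∏ i, r i := by rw [hrN]; exact hpN
      obtain ⟨j, -, hpj⟩ := ((Nat.prime_iff.1 hp).dvd_finsetProd_iff _).1 hpr
      -- `j ∈ admIdxM`: index-admissible, `j ≠ m` (`r_m = 1`), `(r_j, Δ_{mj}) = 1`
      have hjmem : j ∈ admIdxM L m N.minFac := by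
        obtain ⟨-, hrm, hrcop⟩ := mem_dkBoxP_iff.1 hr
        have hjm : j ≠ m := by
          rintro rfl
          rw [hrm] at hpj
          exact hp.one_lt.ne' (Nat.dvd_one.1 hpj)
        refine mem_admIdxM.2 ⟨mem_admIdx.2 (exists_root_of_mem_dkBox hrbox j
          (Nat.mem_primeFactors.2 ⟨hp, hpj, Nat.one_le_iff_ne_zero.1 (one_le_of_mem_dkBox hrbox j)⟩)),
          hjm, fun hΔ => ?_⟩
        have hg := Nat.dvd_gcd hpj hΔ
        rw [(hrcop j hjm).gcd_eq_one] at hg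
        exact hp.one_lt.ne' (Nat.dvd_one.1 hg)
      -- the peeled vector `r' = r/p@j`
      have hr' := update_div_mem_dkBoxP hr j hpj
      have hr'N : (∏ i, Function.update r j (r j / N.minFac) i) = N / N.minFac :=
        (Nat.div_eq_of_eq_mul_right hp.pos (by rw [mul_prod_update_div r j hpj, hrN])).symm
      have IH := ih (N / N.minFac) (Nat.div_lt_self hN0 hp.one_lt) _ hr' hr'N
        ((Nat.div_le_self _ _).trans hNR)
      -- (1) each `s` with `∏s = N` has exactly one coordinate divisible by `p`
      have hone : ∀ s ∈ (dkBoxP L B R m).filter (fun s => (∏ i, s i) = N),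
          ∑ j' ∈ (Finset.univ : Finset (Fin k)),
            (if N.minFac ∣ s j' then localPairSumM L B R m r s else 0) = localPairSumM L B R m r s := by
        intro s hs
        obtain ⟨hsP, hsN⟩ := Finset.mem_filter.1 hs
        have hsbox := dkBoxP_subset L B R m hsP
        have hps : N.minFac ∣ ∏ i, s i := by rw [hsN]; exact hpN
        obtain ⟨j₀, -, hj₀⟩ := ((Nat.prime_iff.1 hp).dvd_finsetProd_iff _).1 hps
        rw [← Finset.sum_filter]
        have hset : Finset.univ.filter (fun j' => N.minFac ∣ s j') = {j₀} := by
          ext i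
          simp only [Finset.mem_filter, Finset.mem_univ, true_and, Finset.mem_singleton]
          constructor
          · intro hpi
            by_contra hne
            have hg := Nat.dvd_gcd hpi hj₀
            rw [(coprime_apply_of_mem_dkBox hsbox hne).gcd_eq_one] at hg
            exact hp.one_lt.ne' (Nat.dvd_one.1 hg)
          · rintro rfl; exact hj₀
        rw [hset, Finset.sum_singleton]
      -- (2) for `j' ∉ admIdxM` no such `s` has `p ∣ s_{j'}`
      have hzero : ∀ j' ∈ (Finset.univ : Finset (Fin k)), j' ∉ admIdxM L m N.minFac →
          ∑ s ∈ ((dkBoxP L B R m).filter (fun s => (∏ i, s i) = N)).filter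
            (fun s => N.minFac ∣ s j'), localPairSumM L B R m r s = 0 := by
        intro j' _ hj'
        refine Finset.sum_eq_zero fun s hs => ?_
        obtain ⟨hs1, hpj'⟩ := Finset.mem_filter.1 hs
        obtain ⟨hsP, -⟩ := Finset.mem_filter.1 hs1
        obtain ⟨hsbox, hsm, hscop⟩ := mem_dkBoxP_iff.1 hsP
        refine (hj' (mem_admIdxM.2 ⟨mem_admIdx.2 (exists_root_of_mem_dkBox hsbox j'
          (Nat.mem_primeFactors.2 ⟨hp, hpj',
            Nat.one_le_iff_ne_zero.1 (one_le_of_mem_dkBox hsbox j')⟩)), ?_, fun hΔ => ?_⟩)).elim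
        · rintro rfl
          rw [hsm] at hpj'
          exact hp.one_lt.ne' (Nat.dvd_one.1 hpj')
        · have hjm : j' ≠ m := by
            rintro rfl
            rw [hsm] at hpj'
            exact hp.one_lt.ne' (Nat.dvd_one.1 hpj')
          have hg := Nat.dvd_gcd hpj' hΔ
          rw [(hscop j' hjm).gcd_eq_one] at hg
          exact hp.one_lt.ne' (Nat.dvd_one.1 hg)
      -- (3) for `j' ∈ admIdxM`: `s ↦ s/p@j'` is a bijection onto `∏s' = N/p`, and (9.12) peels
      have hstep : ∀ j' ∈ admIdxM L m N.minFac,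
          ∑ s ∈ ((dkBoxP L B R m).filter (fun s => (∏ i, s i) = N)).filter
            (fun s => N.minFac ∣ s j'), localPairSumM L B R m r s =
          ∑ s' ∈ (dkBoxP L B R m).filter (fun s => (∏ i, s i) = N / N.minFac),
            (if j = j' then totForm (L m) N.minFac - 1 else -1) *
              localPairSumM L B R m (Function.update r j (r j / N.minFac)) s' := by
        intro j' hj'
        symm
        refine Finset.sum_bij' (fun s' _ => Function.update s' j' (s' j' * N.minFac))
          (fun s _ => Function.update s j' (s j' / N.minFac)) ?_ ?_ ?_ ?_ ?_
        · -- `s'·p@j'` lies in the target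
          intro s' hs'
          obtain ⟨hs'P, hs'N⟩ := Finset.mem_filter.1 hs'
          have hprod : (∏ i, Function.update s' j' (s' j' * N.minFac) i) = N := by
            rw [prod_update_mul, hs'N, Nat.mul_div_cancel' hpN]
          have hb : s' j' * N.minFac ≤ ⌊R⌋₊ := by
            refine le_trans (Nat.le_of_dvd hN0 ?_) hNR
            have h := Finset.dvd_prod_of_mem (Function.update s' j' (s' j' * N.minFac))
              (Finset.mem_univ j')
            rwa [Function.update_self, hprod] at h
          have hps' : ¬ N.minFac ∣ ∏ i, s' i := by rw [hs'N]; exact hndiv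
          refine Finset.mem_filter.2 ⟨Finset.mem_filter.2
            ⟨update_mul_mem_dkBoxP hs'P hp hj' hps' hpW hb, hprod⟩, ?_⟩
          rw [Function.update_self]; exact dvd_mul_left _ _
        · -- `s/p@j'` lies in the source
          intro s hs
          obtain ⟨hs1, hpsj⟩ := Finset.mem_filter.1 hs
          obtain ⟨hsP, hsN⟩ := Finset.mem_filter.1 hs1
          refine Finset.mem_filter.2 ⟨update_div_mem_dkBoxP hsP j' hpsj, ?_⟩
          exact (Nat.div_eq_of_eq_mul_right hp.pos
            (by rw [mul_prod_update_div s j' hpsj, hsN])).symm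
        · intro s' hs'
          rw [Function.update_idem, Function.update_self, Nat.mul_div_cancel _ hp.pos,
            Function.update_eq_self]
        · intro s hs
          obtain ⟨-, hpsj⟩ := Finset.mem_filter.1 hs
          rw [Function.update_idem, Function.update_self, Nat.div_mul_cancel hpsj,
            Function.update_eq_self]
        · -- the summands agree: (9.12) peeling
          intro s' hs'
          obtain ⟨hs'P, hs'N⟩ := Finset.mem_filter.1 hs'
          have hprod : (∏ i, Function.update s' j' (s' j' * N.minFac) i) = N := by
            rw [prod_update_mul, hs'N, Nat.mul_div_cancel' hpN]
          have hb : s' j' * N.minFac ≤ ⌊R⌋₊ := by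
            refine le_trans (Nat.le_of_dvd hN0 ?_) hNR
            have h := Finset.dvd_prod_of_mem (Function.update s' j' (s' j' * N.minFac))
              (Finset.mem_univ j')
            rwa [Function.update_self, hprod] at h
          have hps' : ¬ N.minFac ∣ ∏ i, s' i := by rw [hs'N]; exact hndiv
          have hsP := update_mul_mem_dkBoxP hs'P hp hj' hps' hpW hb
          have hpj' : N.minFac ∣ Function.update s' j' (s' j' * N.minFac) j' := by
            rw [Function.update_self]; exact dvd_mul_left _ _
          rw [localPairSumM_peel hl hr hsP hp hpj hpj', Function.update_self, Function.update_idem,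
            Nat.mul_div_cancel _ hp.pos, Function.update_eq_self]
      -- (4) the sum of the local factors over the restricted admissible indices
      have hsumc : ∑ j' ∈ admIdxM L m N.minFac,
          (if j = j' then totForm (L m) N.minFac - 1 else -1) =
          totForm (L m) N.minFac - #(admIdxM L m N.minFac) := by
        have hsplit : ∀ j' : Fin k, (if j = j' then totForm (L m) N.minFac - 1 else -1) =
            (if j = j' then totForm (L m) N.minFac else 0) - 1 := by
          intro j'; split_ifs <;> ring
        simp_rw [hsplit]
        rw [Finset.sum_sub_distrib, Finset.sum_ite_eq, if_pos hjmem, Finset.sum_const, nsmul_eq_mul,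
          mul_one]
      -- assemble
      calc ∑ s ∈ (dkBoxP L B R m).filter (fun s => (∏ i, s i) = N), localPairSumM L B R m r s
          = ∑ s ∈ (dkBoxP L B R m).filter (fun s => (∏ i, s i) = N),
              ∑ j' ∈ (Finset.univ : Finset (Fin k)),
                (if N.minFac ∣ s j' then localPairSumM L B R m r s else 0) :=
            Finset.sum_congr rfl fun s hs => (hone s hs).symm
        _ = ∑ j' ∈ (Finset.univ : Finset (Fin k)),
              ∑ s ∈ (dkBoxP L B R m).filter (fun s => (∏ i, s i) = N),
                (if N.minFac ∣ s j' then localPairSumM L B R m r s else 0) := Finset.sum_comm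
        _ = ∑ j' ∈ (Finset.univ : Finset (Fin k)),
              ∑ s ∈ ((dkBoxP L B R m).filter (fun s => (∏ i, s i) = N)).filter
                (fun s => N.minFac ∣ s j'), localPairSumM L B R m r s :=
            Finset.sum_congr rfl fun j' _ => (Finset.sum_filter _ _).symm
        _ = ∑ j' ∈ admIdxM L m N.minFac,
              ∑ s ∈ ((dkBoxP L B R m).filter (fun s => (∏ i, s i) = N)).filter
                (fun s => N.minFac ∣ s j'), localPairSumM L B R m r s :=
            (Finset.sum_subset (Finset.subset_univ _) hzero).symm
        _ = ∑ j' ∈ admIdxM L m N.minFac,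
              ∑ s' ∈ (dkBoxP L B R m).filter (fun s => (∏ i, s i) = N / N.minFac),
                (if j = j' then totForm (L m) N.minFac - 1 else -1) *
                  localPairSumM L B R m (Function.update r j (r j / N.minFac)) s' :=
            Finset.sum_congr rfl hstep
        _ = ∑ j' ∈ admIdxM L m N.minFac,
              (if j = j' then totForm (L m) N.minFac - 1 else -1) * phiOmega L (N / N.minFac) := by
            refine Finset.sum_congr rfl fun j' _ => ?_
            rw [← Finset.mul_sum, IH]
        _ = (totForm (L m) N.minFac - #(admIdxM L m N.minFac)) * phiOmega L (N / N.minFac) := by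
            rw [← Finset.sum_mul, hsumc]
        _ = phiOmega L N := by
            rw [totForm_sub_card_admIdxM hadm m hp, ← phiOmega_eq_mul_div L hsqN hp hpN]

/-- **`∑_{s ∈ dkBoxP} T^{(m)}(r,s) = φ_ω(∏ rᵢ)`** for `r ∈ dkBoxP` with `∏rᵢ ≤ ⌊R⌋` (the `s` with
`∏s ≠ ∏r` contribute `0`). [cite: Maynard2016DenseClusters, proof of Prop. 9.2 p. 22, (9.13)–(9.15)] -/
theorem sum_localPairSumM_eq_phiOmega {L : Fin k → ℤ × ℤ} (hadm : FormsAdmissible L) {B : ℕ}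
    {R : ℝ} {m : Fin k} {r : Fin k → ℕ} (hr : r ∈ dkBoxP L B R m) (hrR : (∏ i, r i) ≤ ⌊R⌋₊) :
    ∑ s ∈ dkBoxP L B R m, localPairSumM L B R m r s = phiOmega L (∏ i, r i) := by
  classical
  have h : ∀ s ∈ dkBoxP L B R m, localPairSumM L B R m r s ≠ 0 → (∏ i, s i) = ∏ i, r i := by
    intro s hs hne
    by_contra hc
    exact hne (localPairSumM_eq_zero_of_prod_ne (hadm.1 m) hr hs (fun h => hc h.symm))
  rw [← Finset.sum_filter_of_ne h]
  exact sum_filter_localPairSumM_eq_phiOmega hadm B R m _ r hr rfl hrR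

end Literature.NumberTheory.Sieve.FGKMT2018
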